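import Summits.CriticalPhenomena.CardyFormulaZ2.Theses.CardyDualCurrent
import Literature.Probability.LatticeModels.Sweep1Proofs

/-!
# `TemplateCanonicalLimit` (stmt-CriticalPhenomena-11393): one normalisation suffices

Route `CardyDualCurrent`, sub-problem `CriticalPhenomena/CardyFormulaZ2`. The item quantifies over
EVERY chordal uniformizer `φ : (ℍ; 0, ∞) → (D; a, b)` and EVERY holomorphic branch `q` of
`(ψ'/ψ)^{1/3}` (`ψ = φ⁻¹`), with unit phases `θ_δ` chosen afterwards. This is not stronger than
asking the convergence for ONE uniformizer and ONE branch per domain and family — the form a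
proof à la Smirnov 2010 §5 delivers —, because

* `ψ'/ψ` does not depend on the chordal map (two chordal maps differ by a dilation of `ℍ`;
  `Literature.Probability.LatticeModels.deriv_symm_div_symm_eq_of_isChordalUniformizing`, the
  `σ = 1/2` glue of `Sweep1Proofs`), and
* two continuous cube roots of the zero-free function `ψ'/ψ` on the connected set `D` differ by
  a constant cube root of unity (`cubeRootBranch_exists_const`), which the phases absorb.

`templateCanonicalLimit_of_exists_normalisation` records the resulting `∃ φ, ∃ q` ⇒ `∀ φ, ∀ q`
reduction for the item, verbatim at binder level (the `σ = 1/3`, template analogue of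
`fkIsingObservable_tendstoLocallyUniformlyOn_sqrt_deriv_of_isDiscretisation_of_exists`).
-/

namespace Summit.CriticalPhenomena.CardyFormulaZ2.Theorems

open Summit.CriticalPhenomena.CardyFormulaZ2.Theses.CardyDualCurrent
open Literature.Probability.LatticeModels Literature.Probability.RandomPlanarGeometry
open Literature.Probability.Percolation
open Filter Topology MeasureTheory Set

/-- **Cube-root branches of `ψ'/ψ` differ by a constant unit.** On a Dobrushin domain `D`, two
continuous functions `g, g'` with `g³ = g'³ = ψ'/ψ` (`ψ = φ⁻¹` for a conformal `φ : ℍ → D`)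
satisfy `g' = ω g` on `D` for a constant `ω` with `‖ω‖ = 1` (indeed `ω³ = 1`): `ψ'/ψ` is zero-free
(`deriv_symm_div_symm_ne_zero`), so `g'/g` is continuous on the connected set `D` with values in
the finite set of cube roots of unity, hence constant (`IsPreconnected.constant_of_mapsTo`).
[folklore] -/
theorem cubeRootBranch_exists_const {D : DobrushinDomain}
    (φ : ConformalEquiv UpperHalfPlane.upperHalfPlaneSet D.carrier)
    {g g' : ℂ → ℂ} (hg : ContinuousOn g D.carrier) (hg' : ContinuousOn g' D.carrier)
    (hg3 : ∀ z ∈ D.carrier, g z ^ 3 = deriv φ.symm z / φ.symm z)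
    (hg'3 : ∀ z ∈ D.carrier, g' z ^ 3 = deriv φ.symm z / φ.symm z) :
    ∃ ω : ℂ, ‖ω‖ = 1 ∧ EqOn g' (fun z => ω * g z) D.carrier := by
  obtain ⟨z₀, hz₀⟩ := D.toJordanDomain.nonempty
  have hg0 : ∀ z ∈ D.carrier, g z ≠ 0 := by
    intro z hz h0
    have h1 := hg3 z hz
    rw [h0, zero_pow three_ne_zero] at h1
    exact deriv_symm_div_symm_ne_zero φ hz h1.symm
  set u : ℂ → ℂ := fun z => g' z / g z with hu
  have hu3 : ∀ z ∈ D.carrier, u z ^ 3 = 1 := by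
    intro z hz
    simp only [hu, div_pow, hg3 z hz, hg'3 z hz]
    exact div_self (deriv_symm_div_symm_ne_zero φ hz)
  have huc : ContinuousOn u D.carrier := hg'.div hg hg0
  have hT : ({w : ℂ | w ^ 3 = 1}).Finite := by
    refine (Polynomial.nthRoots 3 (1 : ℂ)).toFinset.finite_toSet.subset fun w hw => ?_
    have hw' : w ^ 3 = 1 := hw
    simp only [Finset.mem_coe, Multiset.mem_toFinset, Polynomial.mem_nthRoots (by norm_num : 0 < 3)]
    exact hw'
  have hconst : ∀ z ∈ D.carrier, u z = u z₀ := fun z hz =>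
    D.isConnected.isPreconnected.constant_of_mapsTo hT.isDiscrete huc (fun w hw => hu3 w hw) hz hz₀
  refine ⟨u z₀, ?_, fun z hz => ?_⟩
  · have h1 : ‖u z₀‖ ^ 3 = 1 := by rw [← norm_pow, hu3 z₀ hz₀, norm_one]
    exact (pow_eq_one_iff_of_nonneg (norm_nonneg _) three_ne_zero).1 h1
  · show g' z = u z₀ * g z
    rw [← hconst z hz, hu, div_mul_cancel₀ _ (hg0 z hz)]

/-- **One normalisation suffices for `TemplateCanonicalLimit`.** If a template `(r, m, z, s, g)`
and `C > 0` are such that for every Dobrushin domain `D` and every `ZdDiscretisationFamily E`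
there are SOME chordal uniformizer `φ`, SOME holomorphic `q` with `q³ = ψ'/ψ` and unit phases
`θ_δ` with `θ_δ · C · δ^{-1/3} · G_{E δ}(⌊w/δ⌋, i) → q` locally uniformly on `D` for both `i`, then
the item holds as stated (for ALL `φ`, `q`): `ψ'/ψ` is independent of `φ`
(`deriv_symm_div_symm_eq_of_isChordalUniformizing`) and another branch `q' = ω q`, `‖ω‖ = 1`
constant (`cubeRootBranch_exists_const`), is reached with the phases `ω θ_δ`.
(Smirnov 2010, §5, paragraph before Remark 5.1, at `σ = 1/3`.) [cite: Smirnov2010, §5 (paragraph before Remark 5.1)] -/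
theorem templateCanonicalLimit_of_exists_normalisation
    (h : ∃ (r m : ℕ) (z : Fin 2 → Fin m → Literature.Probability.LatticeModels.MedialVertex) (s : Fin 2 → Fin m → ℝ) (g : Fin 2 → Fin m → Set Literature.Probability.LatticeModels.MedialVertex → ℂ) (C : ℝ), 0 < C ∧ (∀ i k, Literature.Probability.LatticeModels.medialGraph.edist s((0 : Literature.Probability.LatticeModels.Site 2), Pi.single i 1) (z i k) ≤ (r : ℕ∞)) ∧ (let G : Literature.Probability.LatticeModels.DiscreteDobrushin → Literature.Probability.LatticeModels.Site 2 → Fin 2 → ℂ := fun D x i => ∫ cfg, (∑ k, g i k {e | Literature.Probability.LatticeModels.medialGraph.edist s((0 : Literature.Probability.LatticeModels.Site 2), Pi.single i 1) e ≤ (r : ℕ∞) ∧ Sym2.map (· + x) e ∈ cfg} * Literature.Probability.LatticeModels.passageSum (Literature.Probability.LatticeModels.fkInterface D cfg) D.δ (s i k) (Sym2.map (· + x) (z i k))) ∂(Literature.Probability.Percolation.bondPercolation (Literature.Probability.LatticeModels.zdGraph 2) Literature.Probability.Percolation.half);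
      ∀ (D : DobrushinDomain) (E : ℝ → DiscreteDobrushin), ZdDiscretisationFamily D E →
      ∃ φ : ConformalEquiv UpperHalfPlane.upperHalfPlaneSet D.carrier, D.IsChordalUniformizing φ ∧
      ∃ q : ℂ → ℂ, DifferentiableOn ℂ q D.carrier ∧
        (∀ w ∈ D.carrier, q w ^ 3 = deriv φ.symm w / φ.symm w) ∧
      ∃ θ : ℝ → ℂ, (∀ δ, ‖θ δ‖ = 1) ∧ ∀ i : Fin 2,
        TendstoLocallyUniformlyOn
          (fun (δ : ℝ) (w : ℂ) => θ δ * C * ((δ ^ (-(1 / 3 : ℝ)) : ℝ) : ℂ) *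
            G (E δ) (fun j => ⌊(if j = 0 then w.re else w.im) / δ⌋) i)
          q (𝓝[>] (0 : ℝ)) D.carrier)) :
    TemplateCanonicalLimit := by
  obtain ⟨r, m, z, s, g, C, hC, hz, h⟩ := h
  refine ⟨r, m, z, s, g, C, hC, hz, ?_⟩
  intro G D E hE φ' hφ' q' hq' hq'3
  obtain ⟨φ, hφ, q, hq, hq3, θ, hθ, hlim⟩ := h D E hE
  -- `q'` is a branch of the cube root of the SAME function `ψ'/ψ`
  have hq'3φ : ∀ w ∈ D.carrier, q' w ^ 3 = deriv φ.symm w / φ.symm w := fun w hw =>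
    (hq'3 w hw).trans (deriv_symm_div_symm_eq_of_isChordalUniformizing hφ hφ' hw)
  obtain ⟨ω, hω, heq⟩ := cubeRootBranch_exists_const φ hq.continuousOn hq'.continuousOn hq3 hq'3φ
  refine ⟨fun δ => ω * θ δ, fun δ => by rw [norm_mul, hω, hθ, one_mul], fun i => ?_⟩
  have h2 := (uniformContinuous_const_smul ω).comp_tendstoLocallyUniformlyOn (hlim i)
  refine (h2.congr fun δ w _ => ?_).congr_right fun w hw => ?_
  · simp only [Function.comp_apply, smul_eq_mul]
    ring
  · rw [Function.comp_apply, smul_eq_mul, heq hw]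

end Summit.CriticalPhenomena.CardyFormulaZ2.Theorems
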